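import Literature.IUT.HodgeTheaters.PuncturedEllipticArrowModelKernel
import HarnessLib

/-!
# The finite model of [IUTchI] §1, part 3b: `galKer = K′`, the indices, and `I_{ε′}, I_{ε″} ⥲ Δ_ε⁺` (proof-only)

Mochizuki, *Inter-universal Teichmüller theory I*, kurims manuscript (May 2020), §1 pp. 37–38
([IUTchI] §1 p.38) [claim: Mochizuki2012, status: disputed] (D-0012 claim key; series status DISPUTED —
WITNESS-class, pure finite group theory over the model files of abc-iut-L5-t1; nothing of the series is
asserted, no side is taken on [IUTchIII] Cor. 3.12).

Continuation of `PuncturedEllipticArrowModelKernel.lean` (which proves `jKer = K`): here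
* `Khat_sup_closure_powSet_eq` — `K ⊔ ⟨l-th powers of Π_C̲⟩ = K′ = K ⋊ ⟨s⟩` (p. 38: "`Gal(X̲/C̲) ⊆ Δ_C̲/jKer ≅ ℤ/2l`
  is the subgroup of `l`-th powers"; the `Δ_ε⁺`-coordinate of an `l`-th power is multiplied by `l = 0`);
* the indices `[N : K] = l` (`Δ_ε⁺ ≅ ℤ/l`), `[Π_C̲ : N] = 2`, `[Π_C̲ : K] = 2l`, `[Π_C̲ : K′] = l`, `[Π_C : Π_X] = 2`,
  `[Π_X : N] = l` — via the coordinate homomorphisms `ellN`, `ellC`, `rotIdx` (kernel = the subgroup,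
  surjective onto `ℤ/l`);
* `D_1 ⊔ K = D_{−1} ⊔ K = N` (p. 38 "`I_{ε′} ⥲ Δ_ε⁺`, `I_{ε″} ⥲ Δ_ε⁺`": `ℓ(c_{±1}) = 1`).
PROOF-ONLY (no definition, no instance); symbolic `l`; axioms standard.
-/

namespace Literature.IUT.HodgeTheaters

namespace PuncturedEllipticData

namespace ArrowModel

open DihedralGroup
open scoped Pointwise

variable (l : ℕ)


/-! ### `galKer` of the model: `K ⊔ ⟨l-th powers of Π_C̲⟩ = K′` -/

/-- The `l`-th power of an element of `Π_C̲` lies in `K′` (its `Δ_ε⁺`-coordinate is multiplied by `l = 0`).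
([IUTchI] §1 p.38) [claim: Mochizuki2012, status: disputed] -/
theorem pow_mem_Khat' {c : G l} (hc : c ∈ PiCbarm l) : c ^ l ∈ Khat' l := by
  refine ⟨(PiCbarm l).pow_mem hc l, ?_⟩
  have h := map_pow (ellC l) ⟨c, hc⟩ l
  rw [ellC_apply, ellC_apply, ← ofAdd_nsmul, nsmul_eq_mul, ZMod.natCast_self, zero_mul] at h
  exact Multiplicative.ofAdd.injective h

/-- `ŝ^l = ŝ` (`l` odd). [claim: Mochizuki2012, status: disputed] -/
theorem sigmaHat_pow {q : ℕ} (hq : l = 2 * q + 1) : sigmaHat l ^ l = sigmaHat l := by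
  rw [hq, pow_succ, pow_mul, pow_two, sigmaHat_mul_self, one_pow, one_mul]

/-- **`galKer` of the model**: `K ⊔ ⟨(Π_C̲)^l⟩ = K′`. ([IUTchI] §1 p.38) [claim: Mochizuki2012, status: disputed] -/
theorem Khat_sup_closure_powSet_eq {q : ℕ} (hq : l = 2 * q + 1) :
    Khat l ⊔ Subgroup.closure (powSet l) = Khat' l := by
  refine le_antisymm (sup_le (Khat_le_Khat' l) ?_) ?_
  · rw [Subgroup.closure_le]
    rintro y ⟨c, hc, rfl⟩
    exact pow_mem_Khat' l hc
  · intro g hg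
    rcases eq_of_mem_PiCbarm l (Khat'_le_PiCbarm l hg) with h | h
    · exact Subgroup.mem_sup_left ⟨(congrArg SemidirectProduct.right h).trans (inN_right l _), hg.2⟩
    · rw [h]
      refine Subgroup.mul_mem _ (Subgroup.mem_sup_left ⟨rfl, hg.2⟩) (Subgroup.mem_sup_right ?_)
      refine Subgroup.subset_closure ⟨sigmaHat l, sigmaHat_mem_PiCbarm l, ?_⟩
      exact sigmaHat_pow l hq

/-! ### Indices -/

/-- `N ≤ Π_C̲`. [claim: Mochizuki2012, status: disputed] -/
theorem Nhat_le_PiCbarm : Nhat l ≤ PiCbarm l := fun g hg => Or.inl ((mem_Nhat_iff l g).mp hg)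

/-- `N ≤ Π_X`. [claim: Mochizuki2012, status: disputed] -/
theorem Nhat_le_PiXm : Nhat l ≤ PiXm l := fun g hg => ⟨0, by rw [(mem_Nhat_iff l g).mp hg, r_zero]⟩

/-- `ℓ(B_0-coordinate vector) = t`: the element `(0, single 0 t)` has `Δ_ε⁺`-coordinate `t`.
[claim: Mochizuki2012, status: disputed] -/
theorem ell_single_zero (h2 : 2 ≤ l) (t : ZMod l) : ell l (0, Pi.single (0 : ZMod l) t) = t := by
  haveI : Fact (1 < l) := ⟨by omega⟩
  rw [ell_apply]
  simp

/-- `Ker(ellN) = K ∩ N` (as a subgroup of `N`). [claim: Mochizuki2012, status: disputed] -/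
theorem ker_ellN : (ellN l).ker = (Khat l).subgroupOf (Nhat l) := by
  ext g
  rw [MonoidHom.mem_ker, ellN_apply, Subgroup.mem_subgroupOf, mem_Khat_iff, ofAdd_eq_one]
  exact ⟨fun h => ⟨(mem_Nhat_iff l _).mp g.2, h⟩, fun h => h.2⟩

/-- `ellN` is surjective. [claim: Mochizuki2012, status: disputed] -/
theorem ellN_surjective (h2 : 2 ≤ l) : Function.Surjective (ellN l) := by
  intro m
  refine ⟨⟨inN l (0, Pi.single 0 (Multiplicative.toAdd m)), inN_mem_Nhat l _⟩, ?_⟩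
  rw [ellN_apply]
  change Multiplicative.ofAdd (ell l (Multiplicative.toAdd (Multiplicative.ofAdd _))) = m
  rw [toAdd_ofAdd, ell_single_zero l h2, ofAdd_toAdd]

/-- `|ℤ/l| = l` for the multiplicative copy. [claim: Mochizuki2012, status: disputed] -/
theorem card_multiplicative_zmod [NeZero l] : Nat.card (Multiplicative (ZMod l)) = l := by
  rw [Nat.card_eq_fintype_card, Fintype.card_multiplicative, ZMod.card]

/-- **`[N : K] = l`** (`Δ_X̲/jKer = Δ_ε⁺ ≅ ℤ/l`, p. 38). ([IUTchI] §1 p.38) [claim: Mochizuki2012, status: disputed] -/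
theorem relIndex_Khat_Nhat [NeZero l] (h2 : 2 ≤ l) : (Khat l).relIndex (Nhat l) = l := by
  rw [Subgroup.relIndex, ← ker_ellN, Subgroup.index_ker,
    MonoidHom.range_eq_top.mpr (ellN_surjective l h2), Subgroup.card_top, card_multiplicative_zmod]

/-- **`[Π_C̲ : N] = 2`** (`Gal(X̲/C̲) ≅ ℤ/2`). ([IUTchI] §1 p.37) [claim: Mochizuki2012, status: disputed] -/
theorem relIndex_Nhat_PiCbarm : (Nhat l).relIndex (PiCbarm l) = 2 := by
  rw [Subgroup.relIndex_eq_two_iff]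
  refine ⟨sigmaHat l, sigmaHat_mem_PiCbarm l, fun b hb => ?_⟩
  rw [mem_Nhat_iff, mem_Nhat_iff, SemidirectProduct.mul_right, sigmaHat_right]
  rcases hb with h | h
  · rw [h, one_mul]
    exact Or.inr ⟨rfl, fun h' => by cases h'⟩
  · rw [h, sr_mul_sr, sub_self, r_zero]
    exact Or.inl ⟨rfl, fun h' => by cases h'⟩

/-- **`[Π_C̲ : K] = 2l`** (`Gal(X̲→/C̲) ≅ ℤ/2l`, p. 38). ([IUTchI] §1 p.38) [claim: Mochizuki2012, status: disputed] -/
theorem relIndex_Khat_PiCbarm [NeZero l] (h2 : 2 ≤ l) : (Khat l).relIndex (PiCbarm l) = 2 * l := by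
  rw [← Subgroup.relIndex_mul_relIndex (Khat l) (Nhat l) (PiCbarm l) (Khat_le_Nhat l) (Nhat_le_PiCbarm l),
    relIndex_Khat_Nhat l h2, relIndex_Nhat_PiCbarm, mul_comm]

/-- `Ker(ellC) = K′` (as a subgroup of `Π_C̲`). [claim: Mochizuki2012, status: disputed] -/
theorem ker_ellC : (ellC l).ker = (Khat' l).subgroupOf (PiCbarm l) := by
  ext g
  rw [MonoidHom.mem_ker, ellC_apply, Subgroup.mem_subgroupOf, mem_Khat'_iff, ofAdd_eq_one]
  exact ⟨fun h => ⟨g.2, h⟩, fun h => h.2⟩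

/-- `ellC` is surjective. [claim: Mochizuki2012, status: disputed] -/
theorem ellC_surjective (h2 : 2 ≤ l) : Function.Surjective (ellC l) := by
  intro m
  refine ⟨⟨inN l (0, Pi.single 0 (Multiplicative.toAdd m)), Nhat_le_PiCbarm l (inN_mem_Nhat l _)⟩, ?_⟩
  rw [ellC_apply]
  change Multiplicative.ofAdd (ell l (Multiplicative.toAdd (Multiplicative.ofAdd _))) = m
  rw [toAdd_ofAdd, ell_single_zero l h2, ofAdd_toAdd]

/-- **`[Π_C̲ : K′] = l`** (`Gal(C̲→/C̲) ≅ ℤ/l`, p. 38). ([IUTchI] §1 p.38) [claim: Mochizuki2012, status: disputed] -/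
theorem relIndex_Khat'_PiCbarm [NeZero l] (h2 : 2 ≤ l) : (Khat' l).relIndex (PiCbarm l) = l := by
  rw [Subgroup.relIndex, ← ker_ellC, Subgroup.index_ker,
    MonoidHom.range_eq_top.mpr (ellC_surjective l h2), Subgroup.card_top, card_multiplicative_zmod]

/-- **`[Π_C : Π_X] = 2`**. ([IUTchI] §1 p.37) [claim: Mochizuki2012, status: disputed] -/
theorem index_PiXm : (PiXm l).index = 2 := by
  rw [Subgroup.index_eq_two_iff]
  refine ⟨sigmaHat l, fun g => ?_⟩
  rw [mem_PiXm_iff, mem_PiXm_iff, SemidirectProduct.mul_right, sigmaHat_right]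
  rcases g.right with k | k
  · refine Or.inr ⟨⟨k, rfl⟩, ?_⟩
    rintro ⟨k', hk'⟩
    rw [r_mul_sr] at hk'
    cases hk'
  · refine Or.inl ⟨⟨0 - k, by rw [sr_mul_sr]⟩, ?_⟩
    rintro ⟨k', hk'⟩
    cases hk'

/-- `Ker(rotIdx) = N` (as a subgroup of `Π_X`). [claim: Mochizuki2012, status: disputed] -/
theorem ker_rotIdx : (rotIdx l).ker = (Nhat l).subgroupOf (PiXm l) := by
  ext g
  obtain ⟨k, hk⟩ := g.2
  rw [MonoidHom.mem_ker, rotIdx_apply, Subgroup.mem_subgroupOf, mem_Nhat_iff, hk, rotIndex_r, ofAdd_eq_one,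
    ← r_zero]
  constructor
  · rintro rfl; rfl
  · intro h; cases h; rfl

/-- `rotIdx` is surjective. [claim: Mochizuki2012, status: disputed] -/
theorem rotIdx_surjective : Function.Surjective (rotIdx l) := fun m =>
  ⟨⟨SemidirectProduct.inr (r (Multiplicative.toAdd m)), ⟨Multiplicative.toAdd m, rfl⟩⟩, by
    rw [rotIdx_apply]; rfl⟩

/-- **`[Π_X : N] = l`** (`Gal(X̲/X) ≅ ℤ/l`; the Def. 3.1 (d) numeric). ([IUTchI] §1 p.37)
[claim: Mochizuki2012, status: disputed] -/
theorem relIndex_Nhat_PiXm [NeZero l] : (Nhat l).relIndex (PiXm l) = l := by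
  rw [Subgroup.relIndex, ← ker_rotIdx, Subgroup.index_ker, MonoidHom.range_eq_top.mpr (rotIdx_surjective l),
    Subgroup.card_top, card_multiplicative_zmod]

/-! ### `I_{ε′} ⥲ Δ_ε⁺`, `I_{ε″} ⥲ Δ_ε⁺`: `D_{±1} ⊔ K = N` -/

/-- If `ℓ(c_i) = 1` then `D_i ⊔ K = N`. ([IUTchI] §1 p.38) [claim: Mochizuki2012, status: disputed] -/
theorem Dm_sup_Khat_eq_Nhat [NeZero l] {i : ZMod l} (hi : ell l (cvec l i) = 1) : Dm l i ⊔ Khat l = Nhat l := by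
  refine le_antisymm (sup_le (Dm_le_Nhat l i) (Khat_le_Nhat l)) fun g hg => ?_
  rw [eq_inN_of_right_eq_one l ((mem_Nhat_iff l g).mp hg)]
  set v := Multiplicative.toAdd g.left
  have e : v = (ell l v).val • cvec l i + (v - (ell l v).val • cvec l i) := by rw [add_sub_cancel]
  rw [e, inN_add]
  refine Subgroup.mul_mem _ (Subgroup.mem_sup_left ?_) (Subgroup.mem_sup_right ?_)
  · rw [inN_nsmul]
    exact Subgroup.pow_mem _ (Subgroup.mem_zpowers _) _
  · rw [inN_mem_Khat_iff, map_sub, map_nsmul, hi, nsmul_eq_mul, mul_one, ZMod.natCast_zmod_val, sub_self]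

/-- `δ_j(j) = 1`. [claim: Mochizuki2012, status: disputed] -/
theorem δ_same (j : ZMod l) : δ l j j = 1 := by
  unfold δ; exact Pi.single_eq_same j 1

/-- `δ_j(m) = 0` for `m ≠ j`. [claim: Mochizuki2012, status: disputed] -/
theorem δ_ne {j m : ZMod l} (h : m ≠ j) : δ l j m = 0 := by
  unfold δ; exact Pi.single_eq_of_ne h 1

/-- `ℓ(c_i)` in terms of `δ`'s. [claim: Mochizuki2012, status: disputed] -/
theorem ell_cvec (i : ZMod l) :
    ell l (cvec l i) = (δ l (i + 1) 0 - δ l i 0) - (δ l (i + 1) 1 - δ l i 1) := rfl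

/-- `ℓ(c_1) = 1` (for `3 ≤ l`). [claim: Mochizuki2012, status: disputed] -/
theorem ell_cvec_one (h3 : 3 ≤ l) : ell l (cvec l 1) = 1 := by
  have h20 : (0 : ZMod l) ≠ 1 + 1 := by
    intro h
    have h' : ((2 : ℕ) : ZMod l) = 0 := by push_cast; linear_combination -h
    exact natCast_ne_zero_of_lt l two_pos (by omega) h'
  have h21 : (1 : ZMod l) ≠ 1 + 1 := by
    intro h
    have h' : ((1 : ℕ) : ZMod l) = 0 := by push_cast; linear_combination -h
    exact natCast_ne_zero_of_lt l one_pos (by omega) h'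
  have h10 : (0 : ZMod l) ≠ 1 := by
    intro h
    have h' : ((1 : ℕ) : ZMod l) = 0 := by push_cast; exact h.symm
    exact natCast_ne_zero_of_lt l one_pos (by omega) h'
  rw [ell_cvec, δ_ne l h20, δ_ne l h10, δ_ne l h21, δ_same]
  ring

/-- `ℓ(c_{−1}) = 1` (for `3 ≤ l`). [claim: Mochizuki2012, status: disputed] -/
theorem ell_cvec_neg_one (h3 : 3 ≤ l) : ell l (cvec l (-1)) = 1 := by
  have h10 : (1 : ZMod l) ≠ 0 := by exact_mod_cast natCast_ne_zero_of_lt l (a := 1) one_pos (by omega)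
  have h20 : (2 : ZMod l) ≠ 0 := by exact_mod_cast natCast_ne_zero_of_lt l (a := 2) two_pos (by omega)
  have hm : (0 : ZMod l) ≠ -1 := fun h => h10 (by linear_combination h)
  have hm1 : (1 : ZMod l) ≠ -1 := fun h => h20 (by linear_combination h)
  rw [ell_cvec, neg_add_cancel, δ_same, δ_ne l hm, δ_ne l h10, δ_ne l hm1]
  ring

/-- **`D_1 ⊔ K = N`** (`I_{ε′} ⥲ Δ_ε⁺`). ([IUTchI] §1 p.38) [claim: Mochizuki2012, status: disputed] -/
theorem Dm_one_sup_Khat [NeZero l] (h3 : 3 ≤ l) : Dm l 1 ⊔ Khat l = Nhat l :=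
  Dm_sup_Khat_eq_Nhat l (ell_cvec_one l h3)

/-- **`D_{−1} ⊔ K = N`** (`I_{ε″} ⥲ Δ_ε⁺`). ([IUTchI] §1 p.38) [claim: Mochizuki2012, status: disputed] -/
theorem Dm_neg_one_sup_Khat [NeZero l] (h3 : 3 ≤ l) : Dm l (-1) ⊔ Khat l = Nhat l :=
  Dm_sup_Khat_eq_Nhat l (ell_cvec_neg_one l h3)

end ArrowModel

end PuncturedEllipticData

end Literature.IUT.HodgeTheaters
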